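import Summits.BirchSwinnertonDyer.BirchSwinnertonDyer.Theorems.ManinLocalTwoThreeKummerTriplingSubring
import Summits.BirchSwinnertonDyer.BirchSwinnertonDyer.Theorems.ManinLocalTwoThreeKummerCubeRootThreeBounded
import Mathlib.RingTheory.PowerSeries.Ideal
import HarnessLib

/-!
# A formal cube root is bounded in a subring as soon as its cube is a fraction of cubes of integral series — the UFD step over a PID subring
(route `ManinLocalTwoThree`, crux C3 `ManinPrimeToThreeAtNine` stmt-BirchSwinnertonDyer-22968 — residual RES₃♭, -an g39's `K`-line, stub (BI)_K
`UDCKummerLineK.KummerCubeRootThreeBoundedK`; cell bsd-f2-manin, prover seat p2 gen 18; `--supports stmt-BirchSwinnertonDyer-22968`; infrastructure (I3-generic)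
of p2's (BI)_K plan, STATUS 2026-08-29T17:5xZ/18:0xZ)

p3's (BI) (`KummerCubeRootBounded.kummerCubeRoot_threeAdicallyBounded`, p725131) ends with a UFD step in `ℤ₃⟦q⟧`: `Θ·B³ = A³` (`A, B ∈ ℤ₃⟦q⟧`, `B ≠ 0`),
`3^{K}Θ ∈ ℤ₃⟦q⟧` ⟹ `(3^K A)³ = (3^{3K}Θ)B³` ⟹ `B ∣ 3^K A` ⟹ the normalised cube root `h` has `3^K h ∈ ℤ₃⟦q⟧`.  Here the SAME step over an arbitrary field
`k` and a subring `S ≤ k` that is a PID (so `S⟦X⟧` is a UFD: Mathlib `PowerSeries.Ideal`) containing the cube roots of unity of `k`: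

* `eq_C_mul_of_pow_three_eq` — in `k⟦X⟧` (domain), `x³ = h³` with `h(0) ≠ 0` forces `x = C ω · h` for some `ω ∈ k` with `ω³ = 1`;
* **`exists_C_pow_mul_mem_of_fracCube`** — `π ∈ S ∖ 0`, `C(π^{K₀})·Θ ∈ S⟦X⟧`, `Θ·B³ = A³` with `A, B ∈ S⟦X⟧`, `B ≠ 0`, `h³ = Θ`, `h(0) ≠ 0` ⟹ `C(π^{K₀})·h ∈ S⟦X⟧`
  (`S⟦X⟧` = `(PowerSeries.map S.subtype).range`, p2's `…KummerTriplingSubring`).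

With `kummerTripling_of_subring` (p2) this reduces (BI)_K to: (I3-concrete) a PID structure on the valuation ring of `k = ℚ₃(√r′)`, the `S`-boundedness of `Θ_T`
over `k`, and (I4) the number-field bookkeeping `ℚ(Y₀) ↔ k`.  HONEST FRAMING: infrastructure only; (BI)_K, KLINE, RES₃♭, C3, Manin's conjecture and BSD are NOT
proved.  No sorry, no new axioms. [cite: Washington1997, Thm. 7.3 and §7.1 (shape: power series over a DVR form a UFD)]
-/

set_option autoImplicit false
-- lint-debt: the directory name repeats the summit name (sibling precedent `ManinLocalTwoThreeKummerCubeRootThreeBounded.lean`)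
set_option linter.dupNamespace false

noncomputable section

open scoped Classical
open PowerSeries

namespace Summit.BirchSwinnertonDyer.BirchSwinnertonDyer.Theorems.ManinLocalTwoThree

variable {k : Type*} [Field k]

/-- **Cube roots agree up to a cube root of unity**: in `k⟦X⟧`, `x³ = h³` with `h(0) ≠ 0` gives `x = C ω · h` with `ω ∈ k`, `ω³ = 1`
(`x³ − h³ = (x − h)(x² + xh + h²)`; a root `ω = x/h` of `ω² + ω + 1` in the domain `k⟦X⟧` is one of the two CONSTANT roots `ω₀`, `−1 − ω₀`). [folklore] -/
theorem eq_C_mul_of_pow_three_eq {x h : k⟦X⟧} (hxh : x ^ 3 = h ^ 3) (hh0 : constantCoeff h ≠ 0) :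
    ∃ ω : k, ω ^ 3 = 1 ∧ x = C ω * h := by
  have hne : h ≠ 0 := by
    intro h0; rw [h0, map_zero] at hh0; exact hh0 rfl
  have hunit : IsUnit h := by
    rw [PowerSeries.isUnit_iff_constantCoeff]; exact isUnit_iff_ne_zero.mpr hh0
  obtain ⟨u, hu⟩ := hunit
  set w : k⟦X⟧ := x * ↑u⁻¹ with hw
  have hxw : x = w * h := by rw [hw, ← hu, mul_assoc, Units.inv_mul, mul_one]
  have hw3 : w ^ 3 = 1 := by
    have e : w ^ 3 * h ^ 3 = 1 * h ^ 3 := by rw [← mul_pow, ← hxw, hxh, one_mul]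
    exact mul_right_cancel₀ (pow_ne_zero 3 hne) e
  -- `w` is a constant: `(w − ω₀)(w² + w ω₀ + ω₀²) = w³ − ω₀³`
  set ω₀ : k := constantCoeff w with hω₀
  have hω₀3 : ω₀ ^ 3 = 1 := by rw [hω₀, ← map_pow, hw3, map_one]
  have hfac : (w - C ω₀) * (w ^ 2 + w * C ω₀ + C ω₀ ^ 2) = 0 := by
    have e : (w - C ω₀) * (w ^ 2 + w * C ω₀ + C ω₀ ^ 2) = w ^ 3 - C ω₀ ^ 3 := by ring
    rw [e, hw3, ← map_pow, hω₀3, map_one, sub_self]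
  rcases mul_eq_zero.mp hfac with h1 | h1
  · exact ⟨ω₀, hω₀3, by rw [hxw, sub_eq_zero.mp h1]⟩
  · -- `w² + ω₀w + ω₀² = 0`: then `(w − ω₁)(w + ω₁ + ω₀) = 0` for the constant term `ω₁` of `w`... here `ω₁ = ω₀`, so `3ω₀² = 0`
    -- constant term of `h1`: `3ω₀² = 0`, so `3 = 0` in `k` (as `ω₀ ≠ 0`); then `w² + ω₀ w + ω₀² = (w − ω₀)²` and `w = ω₀` anyway
    have hc : 3 * ω₀ ^ 2 = 0 := by
      have := congrArg constantCoeff h1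
      rw [map_add, map_add, map_mul, map_pow, map_pow, constantCoeff_C, ← hω₀, map_zero] at this
      linear_combination this
    have hω₀ne : ω₀ ≠ 0 := by
      intro h0; rw [h0] at hω₀3; norm_num at hω₀3
    have h3 : (3 : k) = 0 := by
      rcases mul_eq_zero.mp hc with h | h
      · exact h
      · exact absurd (pow_eq_zero_iff two_ne_zero |>.mp h) hω₀ne
    have hsq : (w - C ω₀) ^ 2 = 0 := by
      have e : (w - C ω₀) ^ 2 = (w ^ 2 + w * C ω₀ + C ω₀ ^ 2) - C (3 : k) * (w * C ω₀) := by
        rw [map_ofNat]; ring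
      rw [e, h1, h3, map_zero, zero_mul, sub_zero]
    have hw0 : w - C ω₀ = 0 := pow_eq_zero_iff two_ne_zero |>.mp hsq
    exact ⟨ω₀, hω₀3, by rw [hxw, sub_eq_zero.mp hw0]⟩

/-- **The UFD step over a PID subring**: `S ≤ k` a subring that is a PID and contains every cube root of unity of `k`, `π ∈ S ∖ 0`; if
`C(π^{K₀})·Θ ∈ S⟦X⟧`, `Θ·B³ = A³` with `A, B ∈ S⟦X⟧`, `B ≠ 0`, and `h³ = Θ` with `h(0) ≠ 0`, then `C(π^{K₀})·h ∈ S⟦X⟧`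
(`(π^{K₀}A)³ = (π^{2K₀}·π^{K₀}Θ)·B³` in the UFD `S⟦X⟧` ⟹ `B ∣ π^{K₀}A`, `π^{K₀}A = B·G` ⟹ `(π^{-K₀}G)³ = Θ` ⟹ `π^{-K₀}G = ω·h`). [folklore] -/
theorem exists_C_pow_mul_mem_of_fracCube (S : Subring k) [IsPrincipalIdealRing S] (hω : ∀ ω : k, ω ^ 3 = 1 → ω ∈ S)
    {π : k} (hπS : π ∈ S) (hπ0 : π ≠ 0) {K₀ : ℕ} {Θ h A B : k⟦X⟧}
    (hΘ : C (π ^ K₀) * Θ ∈ (PowerSeries.map S.subtype).range)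
    (hA : A ∈ (PowerSeries.map S.subtype).range) (hB : B ∈ (PowerSeries.map S.subtype).range) (hB0 : B ≠ 0)
    (hcube : Θ * B ^ 3 = A ^ 3) (hh3 : h ^ 3 = Θ) (hh0 : constantCoeff h ≠ 0) :
    C (π ^ K₀) * h ∈ (PowerSeries.map S.subtype).range := by
  set κ : (↥S)⟦X⟧ →+* k⟦X⟧ := PowerSeries.map S.subtype with hκ
  have hκinj : Function.Injective κ := PowerSeries.map_injective _ Subtype.val_injective
  obtain ⟨A₁, hA₁⟩ := hA
  obtain ⟨B₁, hB₁⟩ := hB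
  obtain ⟨Θ₁, hΘ₁⟩ := hΘ
  set π₁ : ↥S := ⟨π, hπS⟩ with hπ₁
  have hκπ : ∀ m : ℕ, κ (C (π₁ ^ m)) = C (π ^ m) := fun m => by
    rw [hκ, map_C, map_pow]; rfl
  -- in the UFD `S⟦X⟧`: `(π^{K₀} A₁)³ = (π^{2K₀} Θ₁)·B₁³`
  have hR : (C (π₁ ^ K₀) * A₁) ^ 3 = B₁ ^ 3 * (C (π₁ ^ (2 * K₀)) * Θ₁) := by
    apply hκinj
    have hκπ1 : κ (C π₁) = C π := by rw [hκ, map_C]; rfl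
    simp only [map_pow, map_mul, hκπ1, hA₁, hB₁, hΘ₁]
    rw [mul_pow, ← hcube]
    ring
  have hB₁0 : B₁ ≠ 0 := fun h0 => hB0 (by rw [← hB₁, h0, map_zero])
  obtain ⟨G₁, hG₁⟩ : B₁ ∣ C (π₁ ^ K₀) * A₁ :=
    (UniqueFactorizationMonoid.pow_dvd_pow_iff_dvd (by norm_num : (3 : ℕ) ≠ 0)).mp ⟨C (π₁ ^ (2 * K₀)) * Θ₁, hR⟩
  -- back in `k⟦X⟧`: `π^{K₀} A = B·G`, so `(G)³ = π^{3K₀} Θ`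
  have hπK0 : (π ^ K₀ : k) ≠ 0 := pow_ne_zero _ hπ0
  set G : k⟦X⟧ := κ G₁ with hG
  have hBG : C (π ^ K₀) * A = B * G := by rw [← hκπ, ← hA₁, ← map_mul, hG₁, map_mul, hB₁]
  set x : k⟦X⟧ := C ((π ^ K₀)⁻¹) * G with hx
  have hx3 : x ^ 3 = Θ := by
    have e1 : (B * G) ^ 3 = C (π ^ K₀) ^ 3 * (Θ * B ^ 3) := by rw [← hBG, mul_pow, hcube]
    have e2 : B ^ 3 * (G ^ 3 - C (π ^ K₀) ^ 3 * Θ) = 0 := by linear_combination e1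
    have hG3 : G ^ 3 = C (π ^ K₀) ^ 3 * Θ := by
      rcases mul_eq_zero.mp e2 with h0 | h0
      · exact absurd (pow_eq_zero_iff three_ne_zero |>.mp h0) hB0
      · exact sub_eq_zero.mp h0
    rw [hx, mul_pow, hG3, ← mul_assoc, ← map_pow, ← map_pow, ← map_mul, ← mul_pow, inv_mul_cancel₀ hπK0, one_pow,
      map_one, one_mul]
  -- `x = ω·h`, so `π^{K₀} h = ω² G ∈ S⟦X⟧`
  obtain ⟨ω, hω3, hxω⟩ := eq_C_mul_of_pow_three_eq (hx3.trans hh3.symm) hh0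
  have hω0 : ω ≠ 0 := by intro h0; rw [h0] at hω3; norm_num at hω3
  have hωinv : ω⁻¹ = ω ^ 2 := inv_eq_of_mul_eq_one_right (by linear_combination hω3)
  have hkey : C (π ^ K₀) * h = C (ω ^ 2) * G := by
    have e : C (π ^ K₀) * x = G := by
      rw [hx, ← mul_assoc, ← map_mul, mul_inv_cancel₀ hπK0, map_one, one_mul]
    have e2 : h = C ω⁻¹ * x := by
      rw [hxω, ← mul_assoc, ← map_mul, inv_mul_cancel₀ hω0, map_one, one_mul]
    rw [e2, hωinv, mul_left_comm, e]
  rw [hkey]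
  exact Subring.mul_mem _ (C_mem_rangeS S (S.pow_mem (hω ω hω3) 2)) ⟨G₁, rfl⟩

end Summit.BirchSwinnertonDyer.BirchSwinnertonDyer.Theorems.ManinLocalTwoThree

end
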